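import Literature.NumberTheory.Sieve.HeathBrownMorozResidueClasses
import Literature.NumberTheory.Sieve.HeathBrownCubicFLProducts
import HarnessLib

/-!
# The coset sequence of Heath-Brown–Moroz as a sifted sequence: density `Γ`, dimension, sifting
# function and density product (the inputs of an upper-bound sieve for `x³ + 2y³` in a class)

Topic `Literature/NumberTheory/Sieve`; companion of `HeathBrownMorozResidueClasses.lean` (the class-box
counts `residueClassPrimeCount`, `residueClassDivCount = #𝒜_q`, the density `typeIDensity = Γ`, the
main term `typeIMainTerm`, and the named facts `HeathBrownMoroz2004_residueClass` (Thm 2) and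
`HeathBrownMoroz2004_typeI_residueClass` (Lemma 2.3/2.4)) and of the tree's sieve set-up for the full box
(`HeathBrownCubicFLSequencesA`: `CubicSieve.seqA`, `densA`, `hasSieveDimension_densA`, `prodA`;
`HeathBrownCubicFLProducts`: `exists_prodA_le`).  Source: D. R. Heath-Brown and B. Z. Moroz, *On primes
represented by cubic polynomials*, Math. Z. 247 (2004) 423–444 = [HeathBrownMoroz2004], §2: for an
admissible class `(a, b) mod d` the multiset `𝒜 = {(a + dx₁)³ + 2(b + dx₂)³ : x⃗ ∈ (X, X(1+η)]²,
(a + dx₁, b + dx₂) = 1}` is sifted with the multiplicative density `Γ(q)` of Lemma 2.4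
(`Γ(p) = ν_p/(p+1)` for `p ∤ d`, `Γ(p) = 0` for `p ∣ d`) and expected size
`[𝒜] = (6/π²)η²X² · ζ(2)/ζ_d(2)` ((2.29) with Lemma 2.4 (iii)); this is the set-up to which the paper (§3,
following Heath-Brown 2001 §6) applies the Fundamental Lemma.

What this file PROVES (no named facts), in the vocabulary of the tree's abstract sieve
(`SieveSequence`, `HasSieveDimension`, `SieveSequence.sifted/congrSum/remainder/densityProduct` of
`LevelOfDistribution.lean` / `SieveFramework.lean`):

* `CubicPrimes.classDensity d` — `Γ` as a multiplicative `ArithmeticFunction ℝ`, equal to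
  `typeIDensity d q` for `q ≠ 0` (`classDensity_apply`), dominated termwise by the full-box density
  `CubicSieve.densA` (`classDensity_prime_le_densA`), hence of (crude) sieve dimension `3` with the
  tree's constant: `hasSieveDimension_classDensity : HasSieveDimension (classDensity d) 3 dimConst`
  (the same bound `ν_p/(p+1) ≤ 3/p, ≤ 1/2` as `hasSieveDimension_densA`; uniform in `d`).
* `CubicPrimes.seqClass X η d a b : SieveSequence` — the coset sequence (weights = number of
  representations by coprime-valued pairs of the class box, size `typeIMainTerm X η d 1 = [𝒜]`,
  density `classDensity d`), with `sifted_seqClass_eq` (`S(𝒜, z)` counts the pairs whose value is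
  coprime to `P(z)`), `congrSum_seqClass_eq` (`𝒜_q(x) = residueClassDivCount … q = #𝒜_q`) and
  `remainder_seqClass_eq` (`R_q = #𝒜_q − typeIMainTerm X η d q`, i.e. EXACTLY the quantity bounded on
  dyadic blocks by `HeathBrownMoroz2004_typeI_residueClass`).
* `CubicPrimes.residueClassPrimeCount_le_sifted` — for `0 < d` and `z ≤ X³` every prime value of the
  class box is `z`-rough, so `π(class box) ≤ S(𝒜, z)` (the upper-bound sieve starts here).
* `CubicPrimes.densityProduct_seqClass_eq` / `_le` — the main-term product factorises as
  `V_𝒜(z) = E_z(d) · V(z)` with `V(z) = CubicSieve.prodA z = ∏_{p<z}(1 − ν_p/(p+1))` (the full-box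
  product, `≤ C/log z` by `CubicSieve.exists_prodA_le`) and
  `E_z(d) = ∏_{p<z, p∣d}(1 − ν_p/(p+1))⁻¹ ≤ coprimeClassWeight d = ∏_{p∣d}(p+1)/(p+1−ν_p)`, the density
  enhancement of an admissible class (`coprimeClassWeight d · zetaTwoCorrection d = classWeight d`,
  `coprimeClassWeight_mul_zetaTwoCorrection`: the factor `σ₁(f)/σ₀` of Theorem 2).

These are the inputs with which the tree's PROVED Fundamental Lemma
(`SieveSequence.fundamental_lemma_uniform_holds`) turns a remainder bound `∑_{q∣P(z), q≤D}|R_q| = o([𝒜]/log X)`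
into the Brun–Titchmarsh bound `π(class box) ≪ coprimeClassWeight d · η²X²/log X`; with the fixed-`d`
Type-I fact the remainder bound holds for each fixed admissible class (up to the term `q = 1`, the
coprime-pair count of the class box, which Lemma 2.3's blocks `Q < q ≤ 2Q` omit).

## References

* [HeathBrownMoroz2004] D. R. Heath-Brown, B. Z. Moroz, *On primes represented by cubic polynomials*,
  Math. Z. 247 (2004), §2: (2.4) `𝒜_q`, Lemma 2.3 (Type I), Lemma 2.4 (`Γ`), (2.29); §3 (3.1)
  (`σ₁(f) = σ₀ ∏_{p∣d} …`).
* [HeathBrownActa2001] D. R. Heath-Brown, *Primes represented by `x³ + 2y³`*, Acta Math. 186 (2001),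
  §6 p. 34 (the Fundamental Lemma applied to `𝒜_q` with `ω(p) = ρ₀(p)`), (6.7).

## Mathlib / tree search

Tree: `CubicPrimes.residueClassDivPairs/Count`, `typeIDensity(_def/_prime/_nonneg/_one)`,
`zetaTwoCorrection(_pos)`, `typeIMainTerm_def`, `classWeight(Factor)`, `mem_residueClassDivPairs_iff`,
`mem_residueClassPrimePairs_iff`, `residueClassPrimePairs_subset_residueClassDivPairs_one`
(`HeathBrownMorozResidueClasses`); `CubicSieve.densA(_prime)`, `dimConst`,
`hasSieveDimension_of_le_div`, `hasSieveDimension_densA`, `prodA`, `prodA_pos_le`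
(`HeathBrownCubicFLSequencesA`, `HeathBrownCubicFLProducts`); `SieveSequence`, `HasSieveDimension`,
`primesProdBelow`, `primeFactors_primesProdBelow`, `coprime_primesProdBelow_iff` (`LevelOfDistribution`,
`SieveFramework`).  `lean search 'classDensity|seqClass|coprimeClassWeight'`: nothing before this file.
-/

noncomputable section

open Finset Filter Topology

namespace Literature.NumberTheory.Sieve.CubicPrimes

open CubicSieve (densA densA_prime dimConst hasSieveDimension_of_le_div prodA prodA_pos_le)

/-! ### The density `Γ` as an arithmetic function, and its sieve dimension -/

/-- Heath-Brown–Moroz's density `Γ` of the coset sequence of an admissible class modulo `d`, as a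
multiplicative arithmetic function: `Γ(q) = ∏_{p ∣ q} Γ(p)`, `Γ(p) = ν_p/(p+1)` for `p ∤ d` and `0` for
`p ∣ d` (it agrees with `typeIDensity d` away from `0`, `classDensity_apply`).
[cite: HeathBrownMoroz2004, Lemma 2.4] -/
def classDensity (d : ℕ) : ArithmeticFunction ℝ :=
  ArithmeticFunction.prodPrimeFactors fun p =>
    if p ∣ d then 0 else (cubeRootTwoCount p : ℝ) / ((p : ℝ) + 1)

/-- `Γ` is multiplicative. [cite: HeathBrownMoroz2004, Lemma 2.4] -/
theorem isMultiplicative_classDensity (d : ℕ) : (classDensity d).IsMultiplicative :=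
  ArithmeticFunction.IsMultiplicative.prodPrimeFactors _

/-- `classDensity d q = typeIDensity d q` for `q ≠ 0`. [cite: HeathBrownMoroz2004, Lemma 2.4] -/
theorem classDensity_apply (d : ℕ) {q : ℕ} (hq : q ≠ 0) : classDensity d q = typeIDensity d q := by
  rw [classDensity, ArithmeticFunction.prodPrimeFactors_apply hq, typeIDensity_def]

/-- `Γ(p)` at a prime. [cite: HeathBrownMoroz2004, Lemma 2.4] -/
theorem classDensity_prime (d : ℕ) {p : ℕ} (hp : p.Prime) :
    classDensity d p = if p ∣ d then 0 else (cubeRootTwoCount p : ℝ) / ((p : ℝ) + 1) := by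
  rw [classDensity_apply d hp.ne_zero, typeIDensity_prime d hp]

/-- `Γ ≥ 0`. [cite: HeathBrownMoroz2004, Lemma 2.4 (i)] -/
theorem classDensity_nonneg (d q : ℕ) : 0 ≤ classDensity d q := by
  rcases eq_or_ne q 0 with rfl | hq
  · simp [classDensity]
  · rw [classDensity_apply d hq]
    exact typeIDensity_nonneg d q

/-- Termwise domination by the full-box density: `Γ(p) ≤ ρ₀(p)/p = ν_p/(p+1)` at every prime (with
equality off `d`). [cite: HeathBrownMoroz2004, Lemma 2.4] -/
theorem classDensity_prime_le_densA (d : ℕ) {p : ℕ} (hp : p.Prime) : classDensity d p ≤ densA p := by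
  rw [classDensity_prime d hp, densA_prime hp]
  split_ifs
  · positivity
  · exact le_rfl

/-- Off `d` the class density is the full-box density. [cite: HeathBrownMoroz2004, Lemma 2.4] -/
theorem classDensity_prime_of_not_dvd (d : ℕ) {p : ℕ} (hp : p.Prime) (hpd : ¬ p ∣ d) :
    classDensity d p = densA p := by
  rw [classDensity_prime d hp, densA_prime hp, if_neg hpd]

/-- On `d` the class density vanishes (an admissible class has no values divisible by `p ∣ d`).
[cite: HeathBrownMoroz2004, Lemma 2.4] -/
theorem classDensity_prime_of_dvd (d : ℕ) {p : ℕ} (hp : p.Prime) (hpd : p ∣ d) :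
    classDensity d p = 0 := by
  rw [classDensity_prime d hp, if_pos hpd]

/-- **`Γ` has (crude) sieve dimension `3` with the tree's constant `dimConst`, uniformly in `d`**:
`0 ≤ Γ(p) ≤ ν_p/(p+1) ≤ 3/p` and `≤ 1/2` (`ν₂ = ν₃ = 1`, `ν_p ≤ 3`), exactly as for the full box
(`CubicSieve.hasSieveDimension_densA`); the true dimension is `1`, the crude value only affects the
constant of the Fundamental Lemma. [cite: HeathBrownActa2001, §6 p. 34] -/
theorem hasSieveDimension_classDensity (d : ℕ) : HasSieveDimension (classDensity d) 3 dimConst := by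
  have h := hasSieveDimension_of_le_div (g := classDensity d) (A := 3) (δ := 1 / 2) (by norm_num)
    (fun p hp => ?_)
  · simpa [dimConst] using h
  have hle := classDensity_prime_le_densA d hp
  rw [densA_prime hp] at hle
  have hp2 : (2 : ℝ) ≤ p := by exact_mod_cast hp.two_le
  have hν : (cubeRootTwoCount p : ℝ) ≤ 3 := by exact_mod_cast cubeRootTwoCount_le_three hp
  have hν0 : (0 : ℝ) ≤ cubeRootTwoCount p := Nat.cast_nonneg _
  refine ⟨classDensity_nonneg d p, hle.trans ?_, hle.trans ?_⟩
  · rw [div_le_div_iff₀ (by linarith) (by linarith)]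
    push_cast
    nlinarith
  · by_cases hp5 : 5 ≤ p
    · have hp5' : (5 : ℝ) ≤ p := by exact_mod_cast hp5
      rw [div_le_iff₀ (by linarith)]
      linarith
    · have hp23 : p = 2 ∨ p = 3 := by
        have := hp.two_le
        interval_cases p
        · exact Or.inl rfl
        · exact Or.inr rfl
        · exact absurd hp (by decide)
      rcases hp23 with rfl | rfl
      · rw [cubeRootTwoCount_two]; norm_num
      · rw [cubeRootTwoCount_three]; norm_num

/-! ### The coset sequence as a `SieveSequence` -/

/-- The value `f(x⃗) = (a + dx₁)³ + 2(b + dx₂)³` of a pair of the class box.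
[cite: HeathBrownMoroz2004, §1 (1.1)] -/
def classValue (d a b : ℕ) (uv : ℕ × ℕ) : ℕ := (a + d * uv.1) ^ 3 + 2 * (b + d * uv.2) ^ 3

/-- `classValue` unfolded. [cite: HeathBrownMoroz2004, §1 (1.1)] -/
theorem classValue_def (d a b : ℕ) (uv : ℕ × ℕ) :
    classValue d a b uv = (a + d * uv.1) ^ 3 + 2 * (b + d * uv.2) ^ 3 := rfl

/-- An upper bound for the values on the class box: `(a + dX(1+η))³ + 2(b + dX(1+η))³` (the height up
to which the sifted sequence lives). [cite: HeathBrownMoroz2004, §1 (1.1)] -/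
def classTop (X η : ℝ) (d a b : ℕ) : ℝ :=
  ((a : ℝ) + d * (X * (1 + η))) ^ 3 + 2 * ((b : ℝ) + d * (X * (1 + η))) ^ 3

/-- **The coset sequence `𝒜` of an admissible class as a sifted sequence**: weights
`a_k = #{x⃗ in the class box, (a + dx₁, b + dx₂) = 1, f(x⃗) = k}`, expected size
`[𝒜] = (6/π²)η²X²·ζ(2)/ζ_d(2) = typeIMainTerm X η d 1`, density `Γ`.
[cite: HeathBrownMoroz2004, §2 (2.4), (2.29), Lemma 2.4] -/
def seqClass (X η : ℝ) (d a b : ℕ) : SieveSequence where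
  a k := (#{uv ∈ residueClassDivPairs X η d a b 1 | classValue d a b uv = k} : ℝ)
  a_nonneg _ := Nat.cast_nonneg _
  size _ := typeIMainTerm X η d 1
  density := classDensity d
  density_mult := isMultiplicative_classDensity d

/-- The expected size `[𝒜] = (6/π²)η²X² ζ(2)/ζ_d(2)` is nonnegative. [cite: HeathBrownMoroz2004, (2.29)] -/
theorem typeIMainTerm_one_nonneg (X η : ℝ) (d : ℕ) : 0 ≤ typeIMainTerm X η d 1 := by
  rw [typeIMainTerm_def, typeIDensity_one, mul_one]
  have := zetaTwoCorrection_pos d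
  positivity

/-- `Γ(q)·[𝒜] = typeIMainTerm X η d q`: the main term of `#𝒜_q` is density times size.
[cite: HeathBrownMoroz2004, Lemma 2.3] -/
theorem classDensity_mul_typeIMainTerm_one (X η : ℝ) (d : ℕ) {q : ℕ} (hq : q ≠ 0) :
    classDensity d q * typeIMainTerm X η d 1 = typeIMainTerm X η d q := by
  rw [classDensity_apply d hq, typeIMainTerm_def, typeIMainTerm_def, typeIDensity_one]
  ring

/-- A coprime-valued pair has a positive value. [cite: HeathBrownMoroz2004, §2 (2.4)] -/
theorem classValue_pos_of_coprime {d a b : ℕ} {uv : ℕ × ℕ}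
    (h : Nat.Coprime (a + d * uv.1) (b + d * uv.2)) : 0 < classValue d a b uv := by
  rw [classValue]
  rcases Nat.eq_zero_or_pos (a + d * uv.1) with h0 | hpos
  · rw [h0] at h
    have hb : b + d * uv.2 = 1 := Nat.coprime_zero_left _ |>.mp h
    rw [h0, hb]; norm_num
  · positivity

/-- The values of the class box lie in `(0, classTop]`. [cite: HeathBrownMoroz2004, §2 (2.4)] -/
theorem classValue_mem_Ioc {X η : ℝ} {d a b : ℕ} {uv : ℕ × ℕ}
    (huv : uv ∈ residueClassDivPairs X η d a b 1) :
    classValue d a b uv ∈ Ioc 0 ⌊classTop X η d a b⌋₊ := by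
  obtain ⟨u, v⟩ := uv
  obtain ⟨-, hu, -, hv, hcop⟩ := mem_residueClassDivPairs_one_iff.mp huv
  rw [mem_Ioc]
  refine ⟨classValue_pos_of_coprime hcop, Nat.le_floor ?_⟩
  rw [classValue, classTop]
  push_cast
  have hd : (0 : ℝ) ≤ d := Nat.cast_nonneg d
  have ha : (0 : ℝ) ≤ a := Nat.cast_nonneg a
  have hb : (0 : ℝ) ≤ b := Nat.cast_nonneg b
  have hu0 : (0 : ℝ) ≤ u := Nat.cast_nonneg u
  have hv0 : (0 : ℝ) ≤ v := Nat.cast_nonneg v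
  have h1 : (a : ℝ) + d * u ≤ a + d * (X * (1 + η)) := by nlinarith
  have h2 : (b : ℝ) + d * v ≤ b + d * (X * (1 + η)) := by nlinarith
  have h1' := pow_le_pow_left₀ (by positivity) h1 3
  have h2' := pow_le_pow_left₀ (by positivity) h2 3
  linarith

/-- **Sums of `𝒜` over a set of integers count pairs**: for any condition `c`,
`∑_{k ≤ classTop, c(k)} a_k = #{x⃗ in the class box, coprime-valued, c(f(x⃗))}`.
[cite: HeathBrownMoroz2004, §2 (2.4)] -/
theorem sum_seqClass_a_filter (X η : ℝ) (d a b : ℕ) (c : ℕ → Prop) [DecidablePred c] :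
    ∑ k ∈ (Ioc 0 ⌊classTop X η d a b⌋₊).filter c, (seqClass X η d a b).a k =
      #{uv ∈ residueClassDivPairs X η d a b 1 | c (classValue d a b uv)} := by
  classical
  have hmaps : Set.MapsTo (classValue d a b)
      ({uv ∈ residueClassDivPairs X η d a b 1 | c (classValue d a b uv)} : Finset (ℕ × ℕ))
      ((Ioc 0 ⌊classTop X η d a b⌋₊).filter c) := by
    intro uv huv
    rw [mem_coe, mem_filter] at huv ⊢
    exact ⟨classValue_mem_Ioc huv.1, huv.2⟩
  rw [card_eq_sum_card_fiberwise hmaps, Nat.cast_sum]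
  refine sum_congr rfl fun k hk => ?_
  simp only [seqClass, filter_filter]
  congr 2
  ext uv
  simp only [mem_filter, and_congr_right_iff]
  intro _
  constructor
  · rintro rfl; exact ⟨(mem_filter.mp hk).2, rfl⟩
  · rintro ⟨-, rfl⟩; rfl

/-- **`S(𝒜, z)` counts the coprime-valued pairs of the class box whose value is coprime to `P(z)`.**
[cite: HeathBrownMoroz2004, §2 (2.4)] -/
theorem sifted_seqClass_eq (X η : ℝ) (d a b : ℕ) (z : ℝ) :
    (seqClass X η d a b).sifted (classTop X η d a b) (primesProdBelow z) =
      #{uv ∈ residueClassDivPairs X η d a b 1 | (classValue d a b uv).Coprime (primesProdBelow z)} := by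
  rw [SieveSequence.sifted, sum_seqClass_a_filter]

/-- **`𝒜_q = #𝒜_q`**: the congruence sums of the coset sequence are the counts `residueClassDivCount`.
[cite: HeathBrownMoroz2004, §2 (2.4)] -/
theorem congrSum_seqClass_eq (X η : ℝ) (d a b q : ℕ) :
    (seqClass X η d a b).congrSum q (classTop X η d a b) = residueClassDivCount X η d a b q := by
  rw [SieveSequence.congrSum, sum_seqClass_a_filter, residueClassDivCount_def, Nat.cast_inj]
  congr 1
  ext ⟨u, v⟩
  rw [mem_filter, mem_residueClassDivPairs_one_iff, mem_residueClassDivPairs_iff, classValue]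
  tauto

/-- **The remainders of the coset sequence are the Type-I errors of Lemma 2.3**:
`R_q = #𝒜_q − typeIMainTerm X η d q` for `q ≠ 0`. [cite: HeathBrownMoroz2004, Lemma 2.3] -/
theorem remainder_seqClass_eq (X η : ℝ) (d a b : ℕ) {q : ℕ} (hq : q ≠ 0) :
    (seqClass X η d a b).remainder q (classTop X η d a b) =
      (residueClassDivCount X η d a b q : ℝ) - typeIMainTerm X η d q := by
  rw [SieveSequence.remainder, congrSum_seqClass_eq, ← classDensity_mul_typeIMainTerm_one X η d hq]
  rfl

/-- **Every prime value of the class box is `z`-rough for `z ≤ X³`** (`0 < d`): the values exceed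
`X³`, so `π(class box) ≤ S(𝒜, z)` — the starting point of the upper-bound sieve.
[cite: HeathBrownActa2001, §6 p. 34] -/
theorem residueClassPrimeCount_le_sifted {X η z : ℝ} (hX : 0 ≤ X) {d : ℕ} (hd : 0 < d) (a b : ℕ)
    (hz : z ≤ X ^ 3) :
    (residueClassPrimeCount X η d a b : ℝ) ≤
      (seqClass X η d a b).sifted (classTop X η d a b) (primesProdBelow z) := by
  rw [sifted_seqClass_eq, residueClassPrimeCount]
  exact_mod_cast card_le_card fun uv huv => by
    obtain ⟨u, v⟩ := uv
    rw [mem_filter]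
    refine ⟨residueClassPrimePairs_subset_residueClassDivPairs_one X η d a b huv, ?_⟩
    obtain ⟨hu, -, -, -, -, hprime⟩ := mem_residueClassPrimePairs_iff.mp huv
    rw [coprime_primesProdBelow_iff]
    intro q hq hdvd
    rw [Nat.mem_primesBelow] at hq
    have hqp : q.Prime := hq.2
    -- `q < z ≤ X³ < u³ ≤ (a + du)³ ≤ value`, so `q ≠ value`; but `q ∣ value` prime forces `q = value`.
    have hval : classValue d a b (u, v) = q := by
      rcases (Nat.dvd_prime hprime).mp hdvd with h1 | h1
      · exact absurd h1 hqp.one_lt.ne'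
      · rw [classValue]; exact h1.symm
    have hlt : (q : ℝ) < z := (Nat.lt_ceil.mp hq.1)
    have hu1 : (u : ℝ) ^ 3 ≤ ((a + d * u : ℕ) : ℝ) ^ 3 := by
      gcongr
      have : (1 : ℝ) ≤ d := by exact_mod_cast hd
      nlinarith [Nat.cast_nonneg (α := ℝ) a, Nat.cast_nonneg (α := ℝ) u]
    have hXu : X ^ 3 < (u : ℝ) ^ 3 := pow_lt_pow_left₀ hu hX three_ne_zero
    have hvalR : ((a + d * u : ℕ) : ℝ) ^ 3 ≤ (classValue d a b (u, v) : ℝ) := by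
      rw [classValue]; push_cast
      have : (0 : ℝ) ≤ ((b : ℝ) + d * v) ^ 3 := by positivity
      linarith
    have : (q : ℝ) < q := by
      calc (q : ℝ) < z := hlt
        _ ≤ X ^ 3 := hz
        _ < (classValue d a b (u, v) : ℝ) := by linarith
        _ = q := by rw [hval]
    exact lt_irrefl _ this

/-! ### The density product: `V_𝒜(z) = E_z(d) · V(z)` -/

/-- The density enhancement of an admissible class restricted to the sifting range:
`E_z(d) = ∏_{p < z, p ∣ d} (1 − ν_p/(p+1))⁻¹`. [cite: HeathBrownMoroz2004, §3 (3.1)] -/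
def classEnhancementBelow (z : ℝ) (d : ℕ) : ℝ :=
  ∏ p ∈ (Nat.primesBelow ⌈z⌉₊).filter (· ∣ d), (1 - densA p)⁻¹

/-- The full density enhancement `∏_{p ∣ d} (p+1)/(p+1−ν_p) = ∏_{p ∣ d}(1 − ν_p/(p+1))⁻¹` of an
admissible class for coprime-valued pairs (the factor `σ₁(f)/σ₀` of Theorem 2 divided by the
coprimality correction `ζ(2)/ζ_d(2)`, see `coprimeClassWeight_mul_zetaTwoCorrection`).
[cite: HeathBrownMoroz2004, §3 (3.1)] -/
def coprimeClassWeight (d : ℕ) : ℝ :=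
  ∏ p ∈ d.primeFactors, (((p : ℝ) + 1) / ((p : ℝ) + 1 - cubeRootTwoCount p))

/-- `1 − ν_p/(p+1) ∈ (0, 1]` at a prime. [cite: HeathBrownMoroz2004, Lemma 2.4 (i)] -/
theorem one_sub_densA_pos_le {p : ℕ} (hp : p.Prime) : 0 < 1 - densA p ∧ 1 - densA p ≤ 1 := by
  obtain ⟨h0, h1⟩ := CubicSieve.hasSieveDimension_densA.1 p hp
  exact ⟨by linarith, by linarith⟩

/-- `(1 − ν_p/(p+1))⁻¹ = (p+1)/(p+1−ν_p)` at a prime. [cite: HeathBrownMoroz2004, §3 (3.1)] -/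
theorem inv_one_sub_densA_eq {p : ℕ} (hp : p.Prime) :
    (1 - densA p)⁻¹ = ((p : ℝ) + 1) / ((p : ℝ) + 1 - cubeRootTwoCount p) := by
  rw [densA_prime hp]
  have hp1 : (0 : ℝ) < (p : ℝ) + 1 := by positivity
  have hν := cast_add_one_sub_cubeRootTwoCount_pos hp
  field_simp

/-- `E_z(d) ≤ coprimeClassWeight d` for `d ≠ 0`: the factors are `≥ 1` and those below `z` are among
all `p ∣ d`. [cite: HeathBrownMoroz2004, §3 (3.1)] -/
theorem classEnhancementBelow_le (z : ℝ) {d : ℕ} (hd : d ≠ 0) :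
    classEnhancementBelow z d ≤ coprimeClassWeight d := by
  classical
  have hsub : (Nat.primesBelow ⌈z⌉₊).filter (· ∣ d) ⊆ d.primeFactors := by
    intro p hp
    rw [mem_filter, Nat.mem_primesBelow] at hp
    exact Nat.mem_primeFactors.mpr ⟨hp.1.2, hp.2, hd⟩
  rw [classEnhancementBelow, coprimeClassWeight, ← prod_sdiff hsub]
  have hS : ∏ p ∈ (Nat.primesBelow ⌈z⌉₊).filter (· ∣ d), (1 - densA p)⁻¹ =
      ∏ p ∈ (Nat.primesBelow ⌈z⌉₊).filter (· ∣ d), ((p : ℝ) + 1) / ((p : ℝ) + 1 - cubeRootTwoCount p) :=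
    prod_congr rfl fun p hp => inv_one_sub_densA_eq (mem_filter.mp hp |>.1 |> Nat.prime_of_mem_primesBelow)
  rw [hS]
  have hge1 : ∀ p ∈ d.primeFactors \ (Nat.primesBelow ⌈z⌉₊).filter (· ∣ d),
      (1 : ℝ) ≤ ((p : ℝ) + 1) / ((p : ℝ) + 1 - cubeRootTwoCount p) := by
    intro p hp
    have hpp : p.Prime := Nat.prime_of_mem_primeFactors (mem_sdiff.mp hp).1
    rw [le_div_iff₀ (cast_add_one_sub_cubeRootTwoCount_pos hpp), one_mul]
    linarith [(Nat.cast_nonneg (cubeRootTwoCount p) : (0 : ℝ) ≤ _)]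
  have hpos : 0 ≤ ∏ p ∈ (Nat.primesBelow ⌈z⌉₊).filter (· ∣ d),
      ((p : ℝ) + 1) / ((p : ℝ) + 1 - cubeRootTwoCount p) :=
    prod_nonneg fun p hp => by
      have hpp : p.Prime := Nat.prime_of_mem_primesBelow (mem_filter.mp hp).1
      exact div_nonneg (by positivity) (cast_add_one_sub_cubeRootTwoCount_pos hpp).le
  calc ∏ p ∈ (Nat.primesBelow ⌈z⌉₊).filter (· ∣ d), ((p : ℝ) + 1) / ((p : ℝ) + 1 - cubeRootTwoCount p)
      = 1 * ∏ p ∈ (Nat.primesBelow ⌈z⌉₊).filter (· ∣ d),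
          ((p : ℝ) + 1) / ((p : ℝ) + 1 - cubeRootTwoCount p) := (one_mul _).symm
    _ ≤ (∏ p ∈ d.primeFactors \ (Nat.primesBelow ⌈z⌉₊).filter (· ∣ d),
          ((p : ℝ) + 1) / ((p : ℝ) + 1 - cubeRootTwoCount p)) *
        ∏ p ∈ (Nat.primesBelow ⌈z⌉₊).filter (· ∣ d),
          ((p : ℝ) + 1) / ((p : ℝ) + 1 - cubeRootTwoCount p) := by
        refine mul_le_mul_of_nonneg_right ?_ hpos
        calc (1 : ℝ) = ∏ p ∈ d.primeFactors \ (Nat.primesBelow ⌈z⌉₊).filter (· ∣ d), (1 : ℝ) :=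
              prod_const_one.symm
          _ ≤ _ := prod_le_prod (fun _ _ => zero_le_one) hge1

/-- **`V_𝒜(z) = E_z(d) · V(z)`**: the density product of the coset sequence over `P(z)` is the full-box
product `CubicSieve.prodA z = ∏_{p<z}(1 − ν_p/(p+1))` times the enhancement `E_z(d)` (the factors at
`p ∣ d` are `1` instead of `1 − ν_p/(p+1)`). [cite: HeathBrownMoroz2004, §3 (3.1)] -/
theorem densityProduct_seqClass_eq (X η : ℝ) (d a b : ℕ) (z : ℝ) :
    (seqClass X η d a b).densityProduct (primesProdBelow z) =
      classEnhancementBelow z d * prodA z := by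
  classical
  rw [SieveSequence.densityProduct, primeFactors_primesProdBelow, classEnhancementBelow, prodA,
    prod_filter, ← prod_mul_distrib]
  refine prod_congr rfl fun p hp => ?_
  have hpp : p.Prime := Nat.prime_of_mem_primesBelow hp
  change 1 - classDensity d p = _
  by_cases hpd : p ∣ d
  · rw [classDensity_prime_of_dvd d hpp hpd, if_pos hpd, sub_zero,
      inv_mul_cancel₀ (one_sub_densA_pos_le hpp).1.ne']
  · rw [classDensity_prime_of_not_dvd d hpp hpd, if_neg hpd, one_mul]

/-- **`V_𝒜(z) ≤ coprimeClassWeight d · V(z)`** for `d ≠ 0` — with `CubicSieve.exists_prodA_le`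
(`V(z) ≤ C/log z`) this is the main term `≪ coprimeClassWeight d · [𝒜]/log z` of the upper-bound sieve.
[cite: HeathBrownMoroz2004, §3 (3.1)] -/
theorem densityProduct_seqClass_le (X η : ℝ) {d : ℕ} (hd : d ≠ 0) (a b : ℕ) (z : ℝ) :
    (seqClass X η d a b).densityProduct (primesProdBelow z) ≤ coprimeClassWeight d * prodA z := by
  rw [densityProduct_seqClass_eq]
  exact mul_le_mul_of_nonneg_right (classEnhancementBelow_le z hd) (prodA_pos_le z).1.le

/-- **Consistency with Theorem 2's class weight**: `coprimeClassWeight d · ζ(2)/ζ_d(2) = classWeight d`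
(`(p+1)/(p+1−ν_p) · (1 − p⁻²)⁻¹ = p²(p+1)/((p²−1)(p+1−ν_p))`). [cite: HeathBrownMoroz2004, §3 (3.1)] -/
theorem coprimeClassWeight_mul_zetaTwoCorrection (d : ℕ) :
    coprimeClassWeight d * zetaTwoCorrection d = classWeight d := by
  rw [coprimeClassWeight, zetaTwoCorrection_def, classWeight, ← prod_mul_distrib]
  refine prod_congr rfl fun p hp => ?_
  have hpp : p.Prime := Nat.prime_of_mem_primeFactors hp
  rw [classWeightFactor]
  have hp2 : (2 : ℝ) ≤ p := by exact_mod_cast hpp.two_le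
  have hν := cast_add_one_sub_cubeRootTwoCount_pos hpp
  have h1 : (0 : ℝ) < (p : ℝ) ^ 2 - 1 := by nlinarith
  have h2 : (p : ℝ) ^ 2 ≠ 0 := by positivity
  have h3 : (1 : ℝ) - ((p : ℝ) ^ 2)⁻¹ = ((p : ℝ) ^ 2 - 1) / (p : ℝ) ^ 2 := by
    field_simp
  rw [h3, inv_div]
  field_simp

/-! ### The upper-bound sieve skeleton: Fundamental Lemma for the coset sequence -/

/-- **The Fundamental Lemma applied to the coset sequence of an admissible class** (the tree's PROVED
uniform Fundamental Lemma `SieveSequence.fundamental_lemma_uniform_holds` at dimension `3`, constant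
`dimConst`, uniform in the class): there is an absolute `C > 0` such that for `0 ≤ X`, `0 < d`,
`2 ≤ z ≤ D`, `z ≤ X³`,
`π(class box) ≤ [𝒜] · coprimeClassWeight d · V(z) · (1 + C e^{−log D/log z}) + ∑_{q ∣ P(z), q ≤ D} |#𝒜_q − typeIMainTerm X η d q|`,
with `[𝒜] = typeIMainTerm X η d 1`, `V(z) = CubicSieve.prodA z`.  Any remainder bound — Lemma 2.3
(`HeathBrownMoroz2004_typeI_residueClass`, fixed `d`, level `X^{3/2}`) or trivial counting (uniform in
`d`, level `(ηX)^{1−ε}`) — turns this into a Brun–Titchmarsh bound for Heath-Brown primes in the class.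
[cite: HeathBrownActa2001, §6 p. 34–35] -/
theorem residueClassPrimeCount_le_fundamentalLemma :
    ∃ C : ℝ, 0 < C ∧ ∀ (X η z D : ℝ) (d a b : ℕ), 0 ≤ X → 0 < d → 2 ≤ z → z ≤ D → z ≤ X ^ 3 →
      (residueClassPrimeCount X η d a b : ℝ) ≤
        typeIMainTerm X η d 1 * (coprimeClassWeight d * prodA z) *
            (1 + C * Real.exp (-(Real.log D / Real.log z))) +
          ∑ q ∈ (primesProdBelow z).divisors.filter (fun q : ℕ => (q : ℝ) ≤ D),
            |(residueClassDivCount X η d a b q : ℝ) - typeIMainTerm X η d q| := by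
  obtain ⟨C, hC, hFL⟩ := SieveSequence.fundamental_lemma_uniform_holds 3 dimConst
  refine ⟨C, hC, fun X η z D d a b hX hd hz hzD hzX => ?_⟩
  have hsize : 0 ≤ (seqClass X η d a b).size (classTop X η d a b) := typeIMainTerm_one_nonneg X η d
  have h := hFL (seqClass X η d a b) (hasSieveDimension_classDensity d) (classTop X η d a b) z D hz hzD
    hsize
  have hV0 : 0 ≤ (seqClass X η d a b).densityProduct (primesProdBelow z) := by
    rw [densityProduct_seqClass_eq]
    refine mul_nonneg (prod_nonneg fun p hp => ?_) (prodA_pos_le z).1.le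
    exact inv_nonneg.mpr (one_sub_densA_pos_le (Nat.prime_of_mem_primesBelow (mem_filter.mp hp).1)).1.le
  have hVle := densityProduct_seqClass_le X η hd.ne' a b z
  have hrem : ∑ q ∈ (primesProdBelow z).divisors.filter (fun q : ℕ => (q : ℝ) ≤ D),
      |(seqClass X η d a b).remainder q (classTop X η d a b)| =
      ∑ q ∈ (primesProdBelow z).divisors.filter (fun q : ℕ => (q : ℝ) ≤ D),
        |(residueClassDivCount X η d a b q : ℝ) - typeIMainTerm X η d q| := by
    refine sum_congr rfl fun q hq => ?_
    have hq0 : q ≠ 0 := by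
      have := Nat.dvd_of_mem_divisors (mem_filter.mp hq).1
      exact fun h => primesProdBelow_ne_zero z (Nat.eq_zero_of_zero_dvd (h ▸ this))
    rw [remainder_seqClass_eq X η d a b hq0]
  have hS := residueClassPrimeCount_le_sifted (η := η) hX hd a b hzX
  have hab := (abs_le.mp h).2
  set S := (seqClass X η d a b).sifted (classTop X η d a b) (primesProdBelow z)
  set M := (seqClass X η d a b).size (classTop X η d a b)
  set V := (seqClass X η d a b).densityProduct (primesProdBelow z)
  have hM : M = typeIMainTerm X η d 1 := rfl
  have hE : 0 ≤ 1 + C * Real.exp (-(Real.log D / Real.log z)) := by positivity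
  calc (residueClassPrimeCount X η d a b : ℝ) ≤ S := hS
    _ ≤ M * V * (1 + C * Real.exp (-(Real.log D / Real.log z))) +
          ∑ q ∈ (primesProdBelow z).divisors.filter (fun q : ℕ => (q : ℝ) ≤ D),
            |(seqClass X η d a b).remainder q (classTop X η d a b)| := by
        linarith
    _ ≤ M * (coprimeClassWeight d * prodA z) * (1 + C * Real.exp (-(Real.log D / Real.log z))) +
          ∑ q ∈ (primesProdBelow z).divisors.filter (fun q : ℕ => (q : ℝ) ≤ D),
            |(residueClassDivCount X η d a b q : ℝ) - typeIMainTerm X η d q| := by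
        rw [hrem]
        have : M * V ≤ M * (coprimeClassWeight d * prodA z) := mul_le_mul_of_nonneg_left hVle hsize
        nlinarith

/-- **Brun–Titchmarsh skeleton with Mertens' bound for the full-box product**: under Heath-Brown's
convergence of the singular product (`HeathBrown2001_singularProduct`, PROVED in the tree as
`HeathBrown2001_singularProduct_holds`) one has `V(z) ≤ C′/log z` (`CubicSieve.exists_prodA_le`), so for
`z ≥ z₀`: `π(class box) ≤ C · coprimeClassWeight d · [𝒜]/log z · (1 + e^{−log D/log z}) + ∑_{q∣P(z), q≤D}|R_q|`
with `C, z₀` absolute (independent of the class). [cite: HeathBrownActa2001, §6 (6.7) and p. 35] -/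
theorem residueClassPrimeCount_le_of_singularProduct (hσ : HeathBrown2001_singularProduct) :
    ∃ C z₀ : ℝ, 0 < C ∧ 2 ≤ z₀ ∧ ∀ (X η z D : ℝ) (d a b : ℕ), 0 ≤ X → 0 < d → z₀ ≤ z → z ≤ D →
      z ≤ X ^ 3 →
      (residueClassPrimeCount X η d a b : ℝ) ≤
        C * coprimeClassWeight d * typeIMainTerm X η d 1 / Real.log z *
            (1 + Real.exp (-(Real.log D / Real.log z))) +
          ∑ q ∈ (primesProdBelow z).divisors.filter (fun q : ℕ => (q : ℝ) ≤ D),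
            |(residueClassDivCount X η d a b q : ℝ) - typeIMainTerm X η d q| := by
  obtain ⟨σ₀, -, hσ⟩ := hσ
  obtain ⟨C₁, hC₁, h₁⟩ := residueClassPrimeCount_le_fundamentalLemma
  obtain ⟨C₂, z₂, hC₂, h₂⟩ := CubicSieve.exists_prodA_le hσ
  refine ⟨max 1 C₁ * C₂ + 1, max 2 z₂, by positivity, le_max_left _ _,
    fun X η z D d a b hX hd hz hzD hzX => ?_⟩
  have hz2 : 2 ≤ z := le_trans (le_max_left _ _) hz
  have hzz : z₂ ≤ z := le_trans (le_max_right _ _) hz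
  have hmain := h₁ X η z D d a b hX hd hz2 hzD hzX
  have hprod := h₂ z hzz
  have hlog : 0 < Real.log z := Real.log_pos (by linarith)
  have hW : 0 ≤ coprimeClassWeight d :=
    prod_nonneg fun p hp => div_nonneg (by positivity)
      (cast_add_one_sub_cubeRootTwoCount_pos (Nat.prime_of_mem_primeFactors hp)).le
  have hM := typeIMainTerm_one_nonneg X η d
  have he : 0 ≤ Real.exp (-(Real.log D / Real.log z)) := (Real.exp_pos _).le
  have hmax1 : (1 : ℝ) ≤ max 1 C₁ := le_max_left _ _
  have hmaxC : C₁ ≤ max 1 C₁ := le_max_right _ _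
  -- `(1 + C₁ e) ≤ max(1, C₁)(1 + e)` and `prodA z ≤ C₂/log z`
  have hfac : 1 + C₁ * Real.exp (-(Real.log D / Real.log z)) ≤
      max 1 C₁ * (1 + Real.exp (-(Real.log D / Real.log z))) := by nlinarith
  have hA0 : 0 ≤ typeIMainTerm X η d 1 * coprimeClassWeight d := mul_nonneg hM hW
  calc (residueClassPrimeCount X η d a b : ℝ)
      ≤ typeIMainTerm X η d 1 * (coprimeClassWeight d * prodA z) *
            (1 + C₁ * Real.exp (-(Real.log D / Real.log z))) +
          ∑ q ∈ (primesProdBelow z).divisors.filter (fun q : ℕ => (q : ℝ) ≤ D),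
            |(residueClassDivCount X η d a b q : ℝ) - typeIMainTerm X η d q| := hmain
    _ ≤ typeIMainTerm X η d 1 * coprimeClassWeight d * (C₂ / Real.log z) *
            (max 1 C₁ * (1 + Real.exp (-(Real.log D / Real.log z)))) +
          ∑ q ∈ (primesProdBelow z).divisors.filter (fun q : ℕ => (q : ℝ) ≤ D),
            |(residueClassDivCount X η d a b q : ℝ) - typeIMainTerm X η d q| := by
        gcongr ?_ + _
        calc typeIMainTerm X η d 1 * (coprimeClassWeight d * prodA z) *
              (1 + C₁ * Real.exp (-(Real.log D / Real.log z)))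
            = typeIMainTerm X η d 1 * coprimeClassWeight d * prodA z *
                (1 + C₁ * Real.exp (-(Real.log D / Real.log z))) := by ring
          _ ≤ typeIMainTerm X η d 1 * coprimeClassWeight d * (C₂ / Real.log z) *
                (max 1 C₁ * (1 + Real.exp (-(Real.log D / Real.log z)))) := by
              have hp0 : 0 ≤ prodA z := (prodA_pos_le z).1.le
              have h1e : 0 ≤ 1 + C₁ * Real.exp (-(Real.log D / Real.log z)) := by positivity
              exact mul_le_mul (mul_le_mul_of_nonneg_left hprod hA0) hfac h1e
                (mul_nonneg hA0 (div_nonneg hC₂ hlog.le))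
    _ ≤ (max 1 C₁ * C₂ + 1) * coprimeClassWeight d * typeIMainTerm X η d 1 / Real.log z *
            (1 + Real.exp (-(Real.log D / Real.log z))) +
          ∑ q ∈ (primesProdBelow z).divisors.filter (fun q : ℕ => (q : ℝ) ≤ D),
            |(residueClassDivCount X η d a b q : ℝ) - typeIMainTerm X η d q| := by
        gcongr ?_ + _
        have hq : 0 ≤ coprimeClassWeight d * typeIMainTerm X η d 1 / Real.log z *
            (1 + Real.exp (-(Real.log D / Real.log z))) := by positivity
        calc typeIMainTerm X η d 1 * coprimeClassWeight d * (C₂ / Real.log z) *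
              (max 1 C₁ * (1 + Real.exp (-(Real.log D / Real.log z))))
            = (max 1 C₁ * C₂) * (coprimeClassWeight d * typeIMainTerm X η d 1 / Real.log z *
                (1 + Real.exp (-(Real.log D / Real.log z)))) := by ring
          _ ≤ (max 1 C₁ * C₂ + 1) * (coprimeClassWeight d * typeIMainTerm X η d 1 / Real.log z *
                (1 + Real.exp (-(Real.log D / Real.log z)))) := by
              exact mul_le_mul_of_nonneg_right (by linarith) hq
          _ = _ := by ring

end Literature.NumberTheory.Sieve.CubicPrimes
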